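import Literature.Topology.PlaneTopology.AnnulusFaces
import Literature.Topology.PlaneTopology.CircleHomeomorphExtension
import Literature.Topology.PlaneTopology.Schoenflies
import Literature.Topology.PlaneTopology.ArcGluing
import HarnessLib

/-!
# The two-dimensional annulus theorem

Topic: Topology / PlaneTopology. **The annulus theorem in the plane** (A. Schoenflies 1906;
E. E. Moise, *Geometric topology in dimensions 2 and 3* (1977), Ch. 4, with the Schoenflies
theorem, Ch. 2 §3 Thm. 4): *the closed region between two nested Jordan curves is a closed
annulus.* We prove it, with control of the boundary values, from results already in the tree —
the Jordan curve theorem (`JordanCurveTheorem_holds`), Newman's cross-cut theorem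
(`Newman1939_crosscut_holds`) and the Schoenflies theorem with prescribed boundary
correspondence (`JordanDomain.exists_homeomorph_eqOn_frontier`, `Schoenflies.lean`):

* `exists_cutData` — a Jordan domain containing the closed unit disc is cut along the first-exit
  radial segments `[1, r₁]`, `[-r₂, -1]` on the real axis; Newman's theorem provides the two
  components (`CutData`, `AnnulusFaces.lean`);
* `CutData.exists_homeomorph` — **cut and paste**: for two cut data (model and target) a
  homeomorphism of `ℂ` equal to the identity on the closed unit disc and mapping the model
  domain, its frontier and its exterior onto those of the target, pasted (`bijOn_piecewise`,
  `continuousOn_piecewise_of_isClosed`) from the identity on the disc, Schoenflies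
  homeomorphisms of the upper faces, of the lower faces and of the outer domains, each
  transferring boundary parameters (`loopTransfer`) so that consecutive pieces agree on the
  common arcs;
* `exists_homeomorph_closedBall_fixed` — model = the disc of radius `2`: a Jordan domain `E`
  containing the closed unit disc is the image of `{‖z‖ < 2}` under a homeomorphism of `ℂ`
  fixing the closed unit disc pointwise; `exists_homeomorph_closedBall_fixed_eqOn` — the same
  with prescribed homeomorphism `{‖z‖ = 2} → ∂E`, up to composing with complex conjugation on
  the unit disc (`exists_homeomorph_extend_circle`, `CircleHomeomorphExtension.lean`);
* `annulus_theorem` — **main statement**: for Jordan domains `closure D₁ ⊆ D₂` and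
  homeomorphisms `g₁ : {‖z‖ = 1} → ∂D₁`, `g₂ : {‖z‖ = 2} → ∂D₂` there is a homeomorphism `H` of
  `ℂ` with `H = g₂` on `{‖z‖ = 2}`, `H = g₁` or `H = g₁ ∘ conj` on `{‖z‖ = 1}`, `H(𝔻) = D₁`,
  `H(2𝔻) = D₂`, `H(ℂ ∖ 2𝔻̄) = ℂ ∖ closure D₂` (the alternative is forced by orientations);
  `exists_homeomorph_image_annulus` — the set form
  `H({1 ≤ ‖z‖ ≤ 2}) = closure D₂ ∖ D₁`;
* `exists_homeomorph_extend_closedBall` — **`0`-handle form**: a homeomorphism of the closed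
  unit disc onto a closed Jordan disc inside `{‖z‖ < 2}` extends, itself or precomposed with
  `conj`, to a homeomorphism of `ℂ` which is the identity on `{‖z‖ ≥ 2}` — the form used to
  straighten charts of topological surfaces (Radó 1925 / Moise 1977 Ch. 8; the `n = 2` leaf of
  the smoothing statement `Literature.Topology.FourManifolds.exists_chartedSpace_isManifold_of_le_three`).

Everything is proved; no named facts. Mathlib has neither the Jordan curve theorem nor any of
these statements.

## References

* E. E. Moise, *Geometric topology in dimensions 2 and 3*, GTM 47, Springer (1977), Ch. 2–4.
* M. H. A. Newman, *Elements of the topology of plane sets of points*, CUP (1939), Ch. V §11. [Newman1939]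
* Ch. Pommerenke, *Boundary Behaviour of Conformal Maps*, Springer (1992), §2.3 Cor. 2.9. [PommerenkeBBCM1992]
-/

noncomputable section

namespace Literature.Topology.PlaneTopology

open Set Metric Real Filter _root_.Topology Bornology
open Literature.Probability.RandomPlanarGeometry (JordanDomain)
open Literature.Probability.RandomPlanarGeometry.JordanDomain

/-! ### Pasting two bijections along a common closed piece -/

section Glue

variable {X Y : Type*} {A A' : Set X} {B B' : Set Y} {f g : X → Y} [∀ x, Decidable (x ∈ A)]

/-- **Pasting bijections.** If `f` maps `A` bijectively onto `B` and `g` maps `A'` bijectively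
onto `B'`, the two agree on `A ∩ A'`, and `B ∩ B'` is covered by the image of `A ∩ A'`, then the
piecewise map is a bijection of `A ∪ A'` onto `B ∪ B'`. [folklore] -/
theorem bijOn_piecewise (hf : BijOn f A B) (hg : BijOn g A' B') (hfg : EqOn f g (A ∩ A'))
    (hBB : B ∩ B' ⊆ f '' (A ∩ A')) : BijOn (A.piecewise f g) (A ∪ A') (B ∪ B') := by
  have hpA : ∀ x ∈ A, A.piecewise f g x = f x := fun x hx => piecewise_eq_of_mem _ _ _ hx
  have hpA' : ∀ x ∈ A', A.piecewise f g x = g x := fun x hx => by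
    by_cases h : x ∈ A
    · rw [piecewise_eq_of_mem _ _ _ h, hfg ⟨h, hx⟩]
    · exact piecewise_eq_of_notMem _ _ _ h
  refine ⟨?_, ?_, ?_⟩
  · rintro x (hx | hx)
    · rw [hpA x hx]; exact Or.inl (hf.mapsTo hx)
    · rw [hpA' x hx]; exact Or.inr (hg.mapsTo hx)
  · -- injectivity: a common value of `f` on `A` and `g` on `A'` comes from `A ∩ A'`
    have key : ∀ x ∈ A, ∀ x' ∈ A', f x = g x' → x = x' := by
      intro x hx x' hx' h
      have hmem : f x ∈ B ∩ B' := ⟨hf.mapsTo hx, h ▸ hg.mapsTo hx'⟩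
      obtain ⟨x'', hx'', hfx''⟩ := hBB hmem
      have h1 : x'' = x := hf.injOn hx''.1 hx hfx''
      subst h1
      exact hg.injOn hx''.2 hx' ((hfg hx'').symm.trans h)
    rintro x (hx | hx) x' (hx' | hx') h
    · rw [hpA x hx, hpA x' hx'] at h; exact hf.injOn hx hx' h
    · rw [hpA x hx, hpA' x' hx'] at h; exact key x hx x' hx' h
    · rw [hpA' x hx, hpA x' hx'] at h; exact (key x' hx' x hx h.symm).symm
    · rw [hpA' x hx, hpA' x' hx'] at h; exact hg.injOn hx hx' h
  · rintro y (hy | hy)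
    · obtain ⟨x, hx, rfl⟩ := hf.surjOn hy
      exact ⟨x, Or.inl hx, hpA x hx⟩
    · obtain ⟨x, hx, rfl⟩ := hg.surjOn hy
      exact ⟨x, Or.inr hx, hpA' x hx⟩

/-- **Pasting continuous maps along closed pieces**: the piecewise map is continuous on
`A ∪ A'` when `A`, `A'` are closed, `f` is continuous on `A`, `g` on `A'`, and they agree on
`A ∩ A'`. [folklore] -/
theorem continuousOn_piecewise_of_isClosed [TopologicalSpace X] [TopologicalSpace Y]
    (hA : IsClosed A) (hA' : IsClosed A') (hf : ContinuousOn f A) (hg : ContinuousOn g A')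
    (hfg : EqOn f g (A ∩ A')) : ContinuousOn (A.piecewise f g) (A ∪ A') := by
  refine ContinuousOn.union_of_isClosed ?_ ?_ hA hA'
  · exact hf.congr fun x hx => piecewise_eq_of_mem _ _ _ hx
  · refine hg.congr fun x hx => ?_
    by_cases h : x ∈ A
    · rw [piecewise_eq_of_mem _ _ _ h, hfg ⟨h, hx⟩]
    · exact piecewise_eq_of_notMem _ _ _ h

/-- The piecewise map agrees with `g` on `A'` (under the agreement hypothesis). [folklore] -/
theorem piecewise_apply_of_mem_right (hfg : EqOn f g (A ∩ A')) {x : X} (hx : x ∈ A') :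
    A.piecewise f g x = g x := by
  by_cases h : x ∈ A
  · rw [piecewise_eq_of_mem _ _ _ h, hfg ⟨h, hx⟩]
  · exact piecewise_eq_of_notMem _ _ _ h

end Glue

/-! ### Cut data from a Jordan domain containing the closed unit disc -/

section Cut

/-- Affine reparametrisation, decreasing: the trace of `u ↦ γ (b - u (b - a))` on `[0, 1]` is
`γ '' [a, b]`. [folklore] -/
theorem image_affine_rev {γ : ℝ → ℂ} {a b : ℝ} (hab : a < b) :
    (fun u => γ (b - u * (b - a))) '' Icc 0 1 = γ '' Icc a b := by
  ext z; constructor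
  · rintro ⟨u, hu, rfl⟩
    exact ⟨b - u * (b - a), ⟨by nlinarith [hu.2], by nlinarith [hu.1]⟩, rfl⟩
  · rintro ⟨v, hv, rfl⟩
    refine ⟨(b - v) / (b - a), ⟨div_nonneg (by linarith [hv.2]) (by linarith),
      (div_le_one (by linarith)).2 (by linarith [hv.1])⟩, ?_⟩
    have hne : b - a ≠ 0 := by linarith
    simp only
    congr 1; field_simp; ring

/-- Affine reparametrisation, increasing: the trace of `u ↦ γ (a + u (b - a))` on `[0, 1]` is
`γ '' [a, b]`. [folklore] -/
theorem image_affine_fwd {γ : ℝ → ℂ} {a b : ℝ} (hab : a < b) :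
    (fun u => γ (a + u * (b - a))) '' Icc 0 1 = γ '' Icc a b := by
  ext z; constructor
  · rintro ⟨u, hu, rfl⟩
    exact ⟨a + u * (b - a), ⟨by nlinarith [hu.1], by nlinarith [hu.2]⟩, rfl⟩
  · rintro ⟨v, hv, rfl⟩
    refine ⟨(v - a) / (b - a), ⟨div_nonneg (by linarith [hv.1]) (by linarith),
      (div_le_one (by linarith)).2 (by linarith [hv.2])⟩, ?_⟩
    have hne : b - a ≠ 0 := by linarith
    simp only
    congr 1; field_simp; ring

/-- **First hit of the frontier along a ray.** For a bounded open set `E` containing the closed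
unit disc and a unit vector direction `±1`, the real half-line from `1` (resp. `-1`) outwards
first leaves `E` at a frontier point `r > 1` (resp. `-r`), all earlier points lying in `E`.
Stated for the map `x ↦ σ x` with `σ = 1` or `σ = -1`. [folklore] -/
theorem exists_first_exit {E : Set ℂ} (hEo : IsOpen E) (hEb : IsBounded E)
    (hE : closedBall (0 : ℂ) 1 ⊆ E) (σ : ℂ) (hσ : ‖σ‖ = 1) :
    ∃ r : ℝ, 1 < r ∧ σ * r ∈ frontier E ∧ ∀ x ∈ Ico (1 : ℝ) r, σ * x ∈ E := by
  obtain ⟨R, hR⟩ := hEb.subset_ball 0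
  have hR1 : 1 < R := by
    have : (1 : ℂ) ∈ ball (0 : ℂ) R := hR (hE (by simp))
    simpa using this
  set η : ℝ → ℂ := fun u => σ * ((1 + u * (R - 1) : ℝ) : ℂ) with hη
  have hηc : Continuous η := by rw [hη]; fun_prop
  have h0 : η 0 ∉ Eᶜ := by
    simp only [hη, zero_mul, add_zero, Complex.ofReal_one, mul_one, mem_compl_iff, not_not]
    exact hE (by simp [hσ])
  have h1 : η 1 ∈ Eᶜ := by
    intro h
    have := hR h
    simp only [hη, one_mul, add_sub_cancel, mem_ball, dist_zero_right, norm_mul, hσ,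
      Complex.norm_real, Real.norm_eq_abs, abs_of_pos (by linarith : (0 : ℝ) < R)] at this
    linarith
  obtain ⟨u₁, hu₁, hu₁C, hlt⟩ := exists_first_hit hηc.continuousOn hEo.isClosed_compl h0 h1
  set r : ℝ := 1 + u₁ * (R - 1) with hr
  have hr1 : 1 < r := by rw [hr]; nlinarith [hu₁.1]
  have hmem : ∀ x ∈ Ico (1 : ℝ) r, σ * x ∈ E := by
    intro x hx
    set u := (x - 1) / (R - 1) with hu
    have hu0 : 0 ≤ u := div_nonneg (by linarith [hx.1]) (by linarith)
    have hR0 : R - 1 ≠ 0 := by linarith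
    have hux : 1 + u * (R - 1) = x := by rw [hu]; field_simp; ring
    have huu₁ : u < u₁ := by
      by_contra hle
      push Not at hle
      have : r ≤ x := by rw [hr, ← hux]; nlinarith
      linarith [hx.2]
    have := hlt u ⟨hu0, huu₁⟩
    simp only [hη, hux, mem_compl_iff, not_not] at this
    exact this
  refine ⟨r, hr1, ?_, hmem⟩
  -- `σ r` is in the closure of `E` (limit of `σ x`, `x → r⁻`) and not in `E`
  rw [frontier_eq_closure_inter_closure, hEo.isClosed_compl.closure_eq]
  refine ⟨?_, by simpa [hη, hr] using hu₁C⟩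
  have hlim : Tendsto (fun x : ℝ => σ * (x : ℂ)) (𝓝[<] r) (𝓝 (σ * (r : ℂ))) :=
    ((continuous_const.mul Complex.continuous_ofReal).tendsto r).mono_left nhdsWithin_le_nhds
  refine mem_closure_of_tendsto hlim ?_
  filter_upwards [Ico_mem_nhdsLT hr1] with x hx using hmem x hx

/-- Normalising a second boundary parameter into the period `(s₁, s₁ + 1)`. [folklore] -/
theorem exists_param_in_period (D : JordanDomain) {s₁ : ℝ} {p : ℂ} (hp : p ∈ frontier D.carrier)
    (hne : p ≠ D.boundary s₁) : ∃ s₂ ∈ Ioo s₁ (s₁ + 1), D.boundary s₂ = p := by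
  rw [← D.range_boundary] at hp
  obtain ⟨s, rfl⟩ := hp
  have hper : D.boundary (s₁ + Int.fract (s - s₁)) = D.boundary s := by
    have e : s₁ + Int.fract (s - s₁) = s - ((⌊s - s₁⌋ : ℤ) : ℝ) * 1 := by rw [Int.fract]; ring
    rw [e]
    exact D.periodic_boundary.sub_int_mul_eq ⌊s - s₁⌋
  refine ⟨s₁ + Int.fract (s - s₁), ⟨?_, by linarith [Int.fract_lt_one (s - s₁)]⟩, hper⟩
  rcases (Int.fract_nonneg (s - s₁)).eq_or_lt with h | h
  · exfalso; apply hne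
    rw [← hper, ← h, add_zero]
  · linarith

/-- **Cut data exist** for every Jordan domain containing the closed unit disc: cut along the
first-exit radial segments on the real axis and apply Newman's cross-cut theorem
(`Newman1939_crosscut_holds`); the unit disc lies in one of the two components, which is
labelled `Vl`. [cite: Newman1939, Ch. V §11, Thms. 11·7 and 11·8, pp. 94–95] -/
theorem exists_cutData (D : JordanDomain) (hD : closedBall (0 : ℂ) 1 ⊆ D.carrier) :
    ∃ c : CutData, c.E = D.carrier := by
  -- the two first exits
  obtain ⟨r₁, hr₁, hr₁f, hray₁⟩ := exists_first_exit D.isOpen D.isBounded hD 1 (by simp)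
  obtain ⟨r₂, hr₂, hr₂f, hray₂⟩ := exists_first_exit D.isOpen D.isBounded hD (-1) (by simp)
  simp only [one_mul] at hr₁f hray₁
  simp only [neg_one_mul] at hr₂f hray₂
  -- boundary parameters `s₁ < s₂ < s₁ + 1` of `r₁` and `-r₂`
  obtain ⟨s₁, hs₁⟩ : ∃ s₁, D.boundary s₁ = r₁ := by
    have := hr₁f; rw [← D.range_boundary] at this; exact this
  have hne : (-(r₂ : ℂ)) ≠ D.boundary s₁ := by
    rw [hs₁]; intro h
    have := congrArg Complex.re h; simp at this; linarith
  obtain ⟨s₂, ⟨hs₁₂, hs₂₁⟩, hs₂⟩ := exists_param_in_period D hr₂f hne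
  -- the two frontier arcs, both parametrised from `-r₂` to `r₁`
  set κA : ℝ → ℂ := fun u => D.boundary (s₂ - u * (s₂ - s₁)) with hκA
  set κB : ℝ → ℂ := fun u => D.boundary (s₂ + u * (s₁ + 1 - s₂)) with hκB
  have hκAc : Continuous κA := D.continuous_boundary.comp (by fun_prop)
  have hκBc : Continuous κB := D.continuous_boundary.comp (by fun_prop)
  have hκAi : InjOn κA (Icc 0 1) := by
    intro u hu v hv h
    have := D.injOn_boundary_Icc (s := s₁) (t := s₂) hs₂₁ ⟨by nlinarith [hu.2], by nlinarith [hu.1]⟩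
      ⟨by nlinarith [hv.2], by nlinarith [hv.1]⟩ h
    have h' : u * (s₂ - s₁) = v * (s₂ - s₁) := by linarith
    exact mul_right_cancel₀ (by linarith) h'
  have hκBi : InjOn κB (Icc 0 1) := by
    intro u hu v hv h
    have := D.injOn_boundary_Icc (s := s₂) (t := s₁ + 1) (by linarith) ⟨by nlinarith [hu.1], by nlinarith [hu.2]⟩
      ⟨by nlinarith [hv.1], by nlinarith [hv.2]⟩ h
    have h' : u * (s₁ + 1 - s₂) = v * (s₁ + 1 - s₂) := by linarith
    exact mul_right_cancel₀ (by linarith) h'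
  have hκA0 : κA 0 = -r₂ := by simp [hκA, hs₂]
  have hκA1 : κA 1 = r₁ := by simp [hκA, hs₁]
  have hκB0 : κB 0 = -r₂ := by simp [hκB, hs₂]
  have hκB1 : κB 1 = r₁ := by
    simp only [hκB, one_mul, add_sub_cancel]
    rw [D.periodic_boundary, hs₁]
  have hκAim : κA '' Icc 0 1 = D.boundary '' Icc s₁ s₂ := image_affine_rev hs₁₂
  have hκBim : κB '' Icc 0 1 = D.boundary '' Icc s₂ (s₁ + 1) := image_affine_fwd hs₂₁
  have hfrontier : frontier D.carrier = D.boundary '' Icc s₁ s₂ ∪ D.boundary '' Icc s₂ (s₁ + 1) :=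
    D.frontier_eq_union_image_boundary s₁ s₂
  have hinterK : D.boundary '' Icc s₁ s₂ ∩ D.boundary '' Icc s₂ (s₁ + 1) ⊆ {(r₁ : ℂ), -(r₂ : ℂ)} := by
    have := D.image_boundary_inter_subset hs₁₂ hs₂₁
    rwa [hs₁, hs₂] at this
  -- the cross-cut `P = [r₁ → 1] · (upper semicircle) · [-1 → -r₂]`
  set P : Set ℂ := rayPos r₁ '' Icc 0 1 ∪ semiUp '' Icc 0 1 ∪ rayNeg r₂ '' Icc 0 1 with hP
  have hsphE : sphere (0 : ℂ) 1 ⊆ D.carrier := sphere_subset_closedBall.trans hD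
  have hnotE : ∀ z ∈ frontier D.carrier, z ∉ D.carrier := fun z hz h =>
    (Set.disjoint_left.1 (Set.disjoint_iff_inter_eq_empty.2 D.isOpen.inter_frontier_eq) h) hz
  have hL₁E : ∀ z ∈ rayPos r₁ '' Icc 0 1, z ≠ r₁ → z ∈ D.carrier := by
    intro z hz hne'
    obtain ⟨x, hx, rfl⟩ := (mem_image_rayPos_iff hr₁).1 hz
    exact hray₁ x ⟨hx.1, hx.2.lt_of_ne fun h => hne' (by subst h; rfl)⟩
  have hL₂E : ∀ z ∈ rayNeg r₂ '' Icc 0 1, z ≠ -r₂ → z ∈ D.carrier := by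
    intro z hz hne'
    obtain ⟨x, hx, rfl⟩ := (mem_image_rayNeg_iff hr₂).1 hz
    exact hray₂ x ⟨hx.1, hx.2.lt_of_ne fun h => hne' (by subst h; rfl)⟩
  have hParc : IsSimpleArc P r₁ (-r₂) := by
    refine ((isSimpleArc_rayPos hr₁).union isSimpleArc_semiUp ?_).union (isSimpleArc_rayNeg hr₂) ?_
    · exact fun z hz => image_rayPos_inter_sphere hr₁ ⟨hz.1, image_semiUp_subset_sphere hz.2⟩
    · rintro z ⟨hz | hz, hz'⟩
      · exact absurd hz' (Set.disjoint_left.1 (disjoint_image_rayPos_image_rayNeg hr₁ hr₂) hz)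
      · exact image_rayNeg_inter_sphere hr₂ ⟨hz', image_semiUp_subset_sphere hz⟩
  have hPsub : P \ {(r₁ : ℂ), -(r₂ : ℂ)} ⊆ D.carrier := by
    rintro z ⟨(hz | hz) | hz, hne'⟩
    · exact hL₁E z hz fun h => hne' (Or.inl h)
    · exact hsphE (image_semiUp_subset_sphere hz)
    · exact hL₂E z hz fun h => hne' (Or.inr h)
  have hcross : D.IsCrosscut P (D.boundary s₁) (D.boundary s₂) := by
    rw [hs₁, hs₂]
    refine ⟨hParc, hr₁f, hr₂f, fun h => ?_, hPsub⟩
    have := congrArg Complex.re h; simp at this; linarith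
  -- Newman
  obtain ⟨V₁, V₂, hV₁o, hV₂o, hV₁c, hV₂c, hdisj, hunion, hfr₁, hfr₂⟩ :=
    Newman1939_crosscut_holds D P s₁ s₂ hs₁₂ hs₂₁ hcross
  -- the unit disc lies in one of the two components
  have hballsub : ball (0 : ℂ) 1 ⊆ V₁ ∪ V₂ := by
    rw [hunion]
    intro z hz
    refine ⟨hD (ball_subset_closedBall hz), ?_⟩
    have hz1 : ‖z‖ < 1 := mem_ball_zero_iff.1 hz
    rintro ((h | h) | h)
    · obtain ⟨x, hx, rfl⟩ := (mem_image_rayPos_iff hr₁).1 h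
      rw [Complex.norm_real, Real.norm_eq_abs] at hz1
      linarith [hx.1, le_abs_self x]
    · have := mem_sphere_zero_iff_norm.1 (image_semiUp_subset_sphere h); linarith
    · obtain ⟨x, hx, rfl⟩ := (mem_image_rayNeg_iff hr₂).1 h
      rw [norm_neg, Complex.norm_real, Real.norm_eq_abs] at hz1
      linarith [hx.1, le_abs_self x]
  have hballconn : IsPreconnected (ball (0 : ℂ) 1) := (convex_ball 0 1).isPreconnected
  rcases hballconn.subset_or_subset hV₁o hV₂o hdisj hballsub with hball | hball
  · -- the disc is in `V₁` (frontier `P ∪ K₁`): `Vl = V₁`, `κl = κA`, `Vu = V₂`, `κu = κB`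
    exact ⟨
      { E := D.carrier
        isOpen_E := D.isOpen
        isBounded_E := D.isBounded
        isConnected_E := D.isConnected
        closedBall_subset := hD
        r₁ := r₁
        r₂ := r₂
        one_lt_r₁ := hr₁
        one_lt_r₂ := hr₂
        ofReal_mem := hray₁
        neg_ofReal_mem := hray₂
        κu := κB
        κl := κA
        continuous_κu := hκBc
        continuous_κl := hκAc
        injOn_κu := hκBi
        injOn_κl := hκAi
        κu_zero := hκB0
        κu_one := hκB1
        κl_zero := hκA0
        κl_one := hκA1
        frontier_E := by rw [hκAim, hκBim, union_comm]; exact hfrontier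
        image_κu_inter_image_κl := by rw [hκAim, hκBim, inter_comm]; exact hinterK
        Vu := V₂
        Vl := V₁
        isOpen_Vu := hV₂o
        isOpen_Vl := hV₁o
        isConnected_Vu := hV₂c
        isConnected_Vl := hV₁c
        disjoint_Vu_Vl := hdisj.symm
        Vu_union_Vl := by rw [union_comm]; exact hunion
        frontier_Vu := by rw [hκBim]; exact hfr₂
        frontier_Vl := by rw [hκAim]; exact hfr₁
        ball_subset_Vl := hball }, rfl⟩
  · -- the disc is in `V₂`: `Vl = V₂`, `κl = κB`, `Vu = V₁`, `κu = κA`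
    exact ⟨
      { E := D.carrier
        isOpen_E := D.isOpen
        isBounded_E := D.isBounded
        isConnected_E := D.isConnected
        closedBall_subset := hD
        r₁ := r₁
        r₂ := r₂
        one_lt_r₁ := hr₁
        one_lt_r₂ := hr₂
        ofReal_mem := hray₁
        neg_ofReal_mem := hray₂
        κu := κA
        κl := κB
        continuous_κu := hκAc
        continuous_κl := hκBc
        injOn_κu := hκAi
        injOn_κl := hκBi
        κu_zero := hκA0
        κu_one := hκA1
        κl_zero := hκB0
        κl_one := hκB1
        frontier_E := by rw [hκAim, hκBim]; exact hfrontier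
        image_κu_inter_image_κl := by rw [hκAim, hκBim]; exact hinterK
        Vu := V₁
        Vl := V₂
        isOpen_Vu := hV₁o
        isOpen_Vl := hV₂o
        isConnected_Vu := hV₁c
        isConnected_Vl := hV₂c
        disjoint_Vu_Vl := hdisj
        Vu_union_Vl := hunion
        frontier_Vu := by rw [hκAim]; exact hfr₁
        frontier_Vl := by rw [hκBim]; exact hfr₂
        ball_subset_Vl := hball }, rfl⟩

end Cut

end Literature.Topology.PlaneTopology

end

noncomputable section

namespace Literature.Topology.PlaneTopology

open Set Metric Real Filter _root_.Topology Bornology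
open Literature.Probability.RandomPlanarGeometry (JordanDomain)
open Literature.Probability.RandomPlanarGeometry.JordanDomain

/-! ### Assembling a homeomorphism from two cut data -/

section Transfer

variable {γ γ' : ℝ → ℂ}

/-- Images of parameter sets under the transfer map: `loopTransfer γ γ' '' (γ '' S) = γ' '' S`.
[folklore] -/
theorem image_loopTransfer_image (hp : Function.Periodic γ 1) (hinj : InjOn γ (Ico 0 1))
    (hp' : Function.Periodic γ' 1) (S : Set ℝ) : loopTransfer γ γ' '' (γ '' S) = γ' '' S := by
  ext z; constructor
  · rintro ⟨_, ⟨t, ht, rfl⟩, rfl⟩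
    exact ⟨t, ht, (loopTransfer_apply hp hinj hp' t).symm⟩
  · rintro ⟨t, ht, rfl⟩
    exact ⟨γ t, ⟨t, ht, rfl⟩, loopTransfer_apply hp hinj hp' t⟩

end Transfer

namespace CutData

variable (cM cT : CutData)

/-- A Schoenflies homeomorphism between the faces / outer domains of two cut data realising the
parameter transfer of the boundary loops: packaged output of
`JordanDomain.exists_homeomorph_eqOn_frontier`. [folklore] -/
theorem exists_homeomorph_transfer (DM DT : JordanDomain) :
    ∃ h : ℂ ≃ₜ ℂ, EqOn h (loopTransfer DM.boundary DT.boundary) (frontier DM.carrier) ∧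
      h '' DM.carrier = DT.carrier ∧ h '' frontier DM.carrier = frontier DT.carrier ∧
      h '' closure DM.carrier = closure DT.carrier ∧
      h '' (closure DM.carrier)ᶜ = (closure DT.carrier)ᶜ ∧
      (∀ t, h (DM.boundary t) = DT.boundary t) ∧
      (∀ S : Set ℝ, h '' (DM.boundary '' S) = DT.boundary '' S) := by
  have hc : ContinuousOn (loopTransfer DM.boundary DT.boundary) (frontier DM.carrier) := by
    rw [← DM.range_boundary]
    exact continuousOn_loopTransfer DM.continuous_boundary DM.periodic_boundary DM.injOn_boundary
      DT.continuous_boundary DT.periodic_boundary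
  have hb : BijOn (loopTransfer DM.boundary DT.boundary) (frontier DM.carrier) (frontier DT.carrier) := by
    rw [← DM.range_boundary, ← DT.range_boundary]
    exact bijOn_loopTransfer DM.periodic_boundary DM.injOn_boundary DT.periodic_boundary DT.injOn_boundary
  obtain ⟨h, hh, hD, hfr, hext⟩ := DM.exists_homeomorph_eqOn_frontier DT hc hb
  have happly : ∀ t, h (DM.boundary t) = DT.boundary t := fun t => by
    rw [hh (DM.boundary_mem_frontier t)]
    exact loopTransfer_apply DM.periodic_boundary DM.injOn_boundary DT.periodic_boundary t
  refine ⟨h, hh, hD, hfr, ?_, hext, happly, fun S => ?_⟩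
  · rw [closure_eq_self_union_frontier, closure_eq_self_union_frontier, image_union, hD, hfr]
  · ext z; constructor
    · rintro ⟨_, ⟨t, ht, rfl⟩, rfl⟩; exact ⟨t, ht, (happly t).symm⟩
    · rintro ⟨t, ht, rfl⟩; exact ⟨DM.boundary t, ⟨t, ht, rfl⟩, happly t⟩

/-- **The homeomorphism attached to two cut data.** Given cut data `cM` (model) and `cT`
(target) there is a homeomorphism `H` of `ℂ` which is the identity on the closed unit disc and
maps `cM.E` onto `cT.E`, `frontier cM.E` onto `frontier cT.E` and the exterior onto the
exterior. It is pasted from the identity on the disc, Schoenflies homeomorphisms of the two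
faces (upper to upper, lower to lower) and a Schoenflies homeomorphism of the outer domains, all
three transferring boundary parameters, so that they agree on the common arcs (Moise 1977,
Ch. 4; the cut-and-paste step of the annulus theorem). [folklore] -/
theorem exists_homeomorph : ∃ H : ℂ ≃ₜ ℂ, (∀ z, ‖z‖ ≤ 1 → H z = z) ∧ H '' cM.E = cT.E ∧
    H '' frontier cM.E = frontier cT.E ∧ H '' (closure cM.E)ᶜ = (closure cT.E)ᶜ := by
  classical
  -- the three Schoenflies homeomorphisms
  obtain ⟨hu, -, huV, hufr, hucl, -, huap, huim⟩ := exists_homeomorph_transfer cM.upperFace cT.upperFace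
  obtain ⟨hl, -, hlV, hlfr, hlcl, -, hlap, hlim⟩ := exists_homeomorph_transfer cM.lowerFace cT.lowerFace
  obtain ⟨ho, -, hoV, hofr, hocl, hoext, hoap, -⟩ := exists_homeomorph_transfer cM.outerDomain cT.outerDomain
  simp only [upperFace_carrier, lowerFace_carrier, outerDomain_carrier, upperFace_boundary,
    lowerFace_boundary, outerDomain_boundary] at huV hufr hucl hlV hlfr hlcl hoV hofr hocl hoext huap hlap hoap
  simp only [upperFace_boundary, lowerFace_boundary] at huim hlim
  -- notation for the pieces
  set A₀ : Set ℂ := closedBall 0 1 with hA₀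
  set A₁ : Set ℂ := closure cM.Vu with hA₁
  set A₂ : Set ℂ := closure cM.Wl with hA₂
  set A₃ : Set ℂ := cM.Eᶜ with hA₃
  set B₁ : Set ℂ := closure cT.Vu with hB₁
  set B₂ : Set ℂ := closure cT.Wl with hB₂
  set B₃ : Set ℂ := cT.Eᶜ with hB₃
  -- values of the face maps on the standard arcs
  have hu_Su : ∀ z ∈ Su, hu z = z := by
    rintro _ ⟨v, hv, rfl⟩
    have e : ∀ c : CutData, quadLoop (rayPos c.r₁) semiUp (rayNeg c.r₂) c.κu ((1 + v) / 4) = semiUp v :=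
      fun c => by rw [quadLoop_apply_of_mem_second c.quadJunction_up ⟨by linarith [hv.1], by linarith [hv.2]⟩]
                  ring_nf
    conv_lhs => rw [← e cM]
    rw [huap, e cT]
  have hl_Sd : ∀ z ∈ Sd, hl z = z := by
    rintro _ ⟨v, hv, rfl⟩
    have e : ∀ c : CutData, quadLoop (rayPos c.r₁) semiDown (rayNeg c.r₂) c.κl ((1 + v) / 4) = semiDown v :=
      fun c => by rw [quadLoop_apply_of_mem_second c.quadJunction_low ⟨by linarith [hv.1], by linarith [hv.2]⟩]
                  ring_nf
    conv_lhs => rw [← e cM]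
    rw [hlap, e cT]
  have hul_L₁ : ∀ z ∈ cM.L₁, hu z = hl z ∧ hu z ∈ cT.L₁ := by
    rintro _ ⟨v, hv, rfl⟩
    have eu : ∀ c : CutData, quadLoop (rayPos c.r₁) semiUp (rayNeg c.r₂) c.κu (v / 4) = rayPos c.r₁ v :=
      fun c => by rw [quadLoop_apply_of_mem_first c.quadJunction_up ⟨by linarith [hv.1], by linarith [hv.2]⟩]
                  ring_nf
    have el : ∀ c : CutData, quadLoop (rayPos c.r₁) semiDown (rayNeg c.r₂) c.κl (v / 4) = rayPos c.r₁ v :=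
      fun c => by rw [quadLoop_apply_of_mem_first c.quadJunction_low ⟨by linarith [hv.1], by linarith [hv.2]⟩]
                  ring_nf
    refine ⟨?_, ?_⟩
    · conv_lhs => rw [← eu cM, huap, eu cT]
      rw [← el cM, hlap, el cT]
    · rw [← eu cM, huap, eu cT]; exact ⟨v, hv, rfl⟩
  have hul_L₂ : ∀ z ∈ cM.L₂, hu z = hl z ∧ hu z ∈ cT.L₂ := by
    rintro _ ⟨v, hv, rfl⟩
    have eu : ∀ c : CutData, quadLoop (rayPos c.r₁) semiUp (rayNeg c.r₂) c.κu ((2 + v) / 4) = rayNeg c.r₂ v :=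
      fun c => by rw [quadLoop_apply_of_mem_third c.quadJunction_up ⟨by linarith [hv.1], by linarith [hv.2]⟩]
                  ring_nf
    have el : ∀ c : CutData, quadLoop (rayPos c.r₁) semiDown (rayNeg c.r₂) c.κl ((2 + v) / 4) = rayNeg c.r₂ v :=
      fun c => by rw [quadLoop_apply_of_mem_third c.quadJunction_low ⟨by linarith [hv.1], by linarith [hv.2]⟩]
                  ring_nf
    refine ⟨?_, ?_⟩
    · conv_lhs => rw [← eu cM, huap, eu cT]
      rw [← el cM, hlap, el cT]
    · rw [← eu cM, huap, eu cT]; exact ⟨v, hv, rfl⟩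
  have huo_Ku : ∀ z ∈ cM.Ku, hu z = ho z ∧ hu z ∈ cT.Ku := by
    rintro _ ⟨v, hv, rfl⟩
    have eu : ∀ c : CutData, quadLoop (rayPos c.r₁) semiUp (rayNeg c.r₂) c.κu ((3 + v) / 4) = c.κu v :=
      fun c => by rw [quadLoop_apply_of_mem_fourth c.quadJunction_up ⟨by linarith [hv.1], by linarith [hv.2]⟩]
                  ring_nf
    refine ⟨?_, ?_⟩
    · conv_lhs => rw [← eu cM, huap, eu cT]
      rw [← cM.outerLoop_half_mul hv, hoap, cT.outerLoop_half_mul hv]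
    · rw [← eu cM, huap, eu cT]; exact ⟨v, hv, rfl⟩
  have hlo_Kl : ∀ z ∈ cM.Kl, hl z = ho z ∧ hl z ∈ cT.Kl := by
    rintro _ ⟨v, hv, rfl⟩
    have el : ∀ c : CutData, quadLoop (rayPos c.r₁) semiDown (rayNeg c.r₂) c.κl ((3 + v) / 4) = c.κl v :=
      fun c => by rw [quadLoop_apply_of_mem_fourth c.quadJunction_low ⟨by linarith [hv.1], by linarith [hv.2]⟩]
                  ring_nf
    refine ⟨?_, ?_⟩
    · conv_lhs => rw [← el cM, hlap, el cT]
      rw [← cM.outerLoop_one_sub_half_mul hv, hoap, cT.outerLoop_one_sub_half_mul hv]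
    · rw [← el cM, hlap, el cT]; exact ⟨v, hv, rfl⟩
  -- images of the arcs
  have hu_L₁ : hu '' cM.L₁ = cT.L₁ := by
    show hu '' (rayPos cM.r₁ '' Icc 0 1) = rayPos cT.r₁ '' Icc 0 1
    rw [← image_quadLoop_first cM.quadJunction_up, huim, image_quadLoop_first cT.quadJunction_up]
  have hu_L₂ : hu '' cM.L₂ = cT.L₂ := by
    show hu '' (rayNeg cM.r₂ '' Icc 0 1) = rayNeg cT.r₂ '' Icc 0 1
    rw [← image_quadLoop_third cM.quadJunction_up, huim, image_quadLoop_third cT.quadJunction_up]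
  have hu_Ku : hu '' cM.Ku = cT.Ku := by
    show hu '' (cM.κu '' Icc 0 1) = cT.κu '' Icc 0 1
    rw [← image_quadLoop_fourth cM.quadJunction_up, huim, image_quadLoop_fourth cT.quadJunction_up]
  have hl_Kl : hl '' cM.Kl = cT.Kl := by
    show hl '' (cM.κl '' Icc 0 1) = cT.κl '' Icc 0 1
    rw [← image_quadLoop_fourth cM.quadJunction_low, hlim, image_quadLoop_fourth cT.quadJunction_low]
  -- images of the pieces
  have hu_A₁ : hu '' A₁ = B₁ := hucl
  have hl_A₂ : hl '' A₂ = B₂ := hlcl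
  have ho_A₃ : ho '' A₃ = B₃ := by
    rw [hA₃, hB₃, cM.compl_E_eq, cT.compl_E_eq, image_union, hoext, hofr]
  have hbij₁ : BijOn hu A₁ B₁ := hu_A₁ ▸ hu.injective.injOn.bijOn_image
  have hbij₂ : BijOn hl A₂ B₂ := hl_A₂ ▸ hl.injective.injOn.bijOn_image
  have hbij₃ : BijOn ho A₃ B₃ := ho_A₃ ▸ ho.injective.injOn.bijOn_image
  -- closedness and boundedness of the pieces
  have hA₁c : IsClosed A₁ := isClosed_closure
  have hA₂c : IsClosed A₂ := isClosed_closure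
  have hA₃c : IsClosed A₃ := cM.isOpen_E.isClosed_compl
  -- step 1: paste `hl` and `ho`
  set g₂₃ : ℂ → ℂ := A₂.piecewise hl ho with hg₂₃
  have hagree₂₃ : EqOn hl ho (A₂ ∩ A₃) := fun z hz => by
    rw [hA₂, hA₃, cM.closure_Wl_inter_compl] at hz
    exact (hlo_Kl z hz).1
  have hbij₂₃ : BijOn g₂₃ (A₂ ∪ A₃) (B₂ ∪ B₃) := by
    refine bijOn_piecewise hbij₂ hbij₃ hagree₂₃ ?_
    rw [hB₂, hB₃, cT.closure_Wl_inter_compl, hA₂, hA₃, cM.closure_Wl_inter_compl, hl_Kl]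
  have hcont₂₃ : ContinuousOn g₂₃ (A₂ ∪ A₃) :=
    continuousOn_piecewise_of_isClosed hA₂c hA₃c hl.continuous.continuousOn ho.continuous.continuousOn hagree₂₃
  have hg₂₃_A₂ : ∀ z ∈ A₂, g₂₃ z = hl z := fun z hz => piecewise_eq_of_mem _ _ _ hz
  have hg₂₃_A₃ : ∀ z ∈ A₃, g₂₃ z = ho z := fun z hz => piecewise_apply_of_mem_right hagree₂₃ hz
  -- step 2: paste `hu`
  set g₁₂₃ : ℂ → ℂ := A₁.piecewise hu g₂₃ with hg₁₂₃
  have hagree₁ : EqOn hu g₂₃ (A₁ ∩ (A₂ ∪ A₃)) := by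
    rintro z ⟨hz₁, hz⟩
    by_cases hz₂ : z ∈ A₂
    · rw [hg₂₃_A₂ z hz₂]
      have : z ∈ A₁ ∩ A₂ := ⟨hz₁, hz₂⟩
      rw [hA₁, hA₂, cM.closure_Vu_inter_closure_Wl] at this
      rcases this with h | h
      · exact (hul_L₁ z h).1
      · exact (hul_L₂ z h).1
    · have hz₃ : z ∈ A₃ := hz.resolve_left hz₂
      rw [hg₂₃_A₃ z hz₃]
      have : z ∈ A₁ ∩ A₃ := ⟨hz₁, hz₃⟩
      rw [hA₁, hA₃, cM.closure_Vu_inter_compl] at this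
      exact (huo_Ku z this).1
  have hbij₁₂₃ : BijOn g₁₂₃ (A₁ ∪ (A₂ ∪ A₃)) (B₁ ∪ (B₂ ∪ B₃)) := by
    refine bijOn_piecewise hbij₁ hbij₂₃ hagree₁ ?_
    rintro y ⟨hy₁, hy | hy⟩
    · have : y ∈ B₁ ∩ B₂ := ⟨hy₁, hy⟩
      rw [hB₁, hB₂, cT.closure_Vu_inter_closure_Wl, ← hu_L₁, ← hu_L₂, ← image_union] at this
      obtain ⟨x, hx, rfl⟩ := this
      refine ⟨x, ⟨?_, Or.inl ?_⟩, rfl⟩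
      · rw [hA₁, cM.closure_Vu_eq]
        rcases hx with hx | hx
        · exact Or.inr (Or.inl (Or.inl (Or.inl hx)))
        · exact Or.inr (Or.inl (Or.inr hx))
      · rw [hA₂, cM.closure_Wl_eq]
        rcases hx with hx | hx
        · exact Or.inr (Or.inl (Or.inl (Or.inl hx)))
        · exact Or.inr (Or.inl (Or.inr hx))
    · have : y ∈ B₁ ∩ B₃ := ⟨hy₁, hy⟩
      rw [hB₁, hB₃, cT.closure_Vu_inter_compl, ← hu_Ku] at this
      obtain ⟨x, hx, rfl⟩ := this
      have hx' : x ∈ A₁ ∩ A₃ := by rw [hA₁, hA₃, cM.closure_Vu_inter_compl]; exact hx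
      exact ⟨x, ⟨hx'.1, Or.inr hx'.2⟩, rfl⟩
  have hcont₁₂₃ : ContinuousOn g₁₂₃ (A₁ ∪ (A₂ ∪ A₃)) :=
    continuousOn_piecewise_of_isClosed hA₁c (hA₂c.union hA₃c) hu.continuous.continuousOn hcont₂₃ hagree₁
  have hg₁₂₃_A₁ : ∀ z ∈ A₁, g₁₂₃ z = hu z := fun z hz => piecewise_eq_of_mem _ _ _ hz
  have hg₁₂₃_A₂₃ : ∀ z ∈ A₂ ∪ A₃, g₁₂₃ z = g₂₃ z := fun z hz => piecewise_apply_of_mem_right hagree₁ hz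
  -- step 3: paste the identity on the closed unit disc
  set H : ℂ → ℂ := A₀.piecewise id g₁₂₃ with hH
  have hcover : A₀ ∪ (A₁ ∪ (A₂ ∪ A₃)) = univ := by
    rw [hA₀, hA₁, hA₂, hA₃, ← union_assoc, ← union_assoc]; exact cM.union_eq_univ
  have hcoverT : A₀ ∪ (B₁ ∪ (B₂ ∪ B₃)) = univ := by
    rw [hA₀, hB₁, hB₂, hB₃, ← union_assoc, ← union_assoc]; exact cT.union_eq_univ
  have hagree₀ : EqOn id g₁₂₃ (A₀ ∩ (A₁ ∪ (A₂ ∪ A₃))) := by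
    rintro z ⟨hz₀, hz⟩
    by_cases hz₁ : z ∈ A₁
    · rw [hg₁₂₃_A₁ z hz₁]
      have : z ∈ closure cM.Vu ∩ closedBall 0 1 := ⟨hz₁, hz₀⟩
      rw [cM.closure_Vu_inter_closedBall] at this
      exact (hu_Su z this).symm
    · have hz₂₃ : z ∈ A₂ ∪ A₃ := hz.resolve_left hz₁
      rw [hg₁₂₃_A₂₃ z hz₂₃]
      rcases hz₂₃ with hz₂ | hz₃
      · rw [hg₂₃_A₂ z hz₂]
        have : z ∈ closure cM.Wl ∩ closedBall 0 1 := ⟨hz₂, hz₀⟩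
        rw [cM.closure_Wl_inter_closedBall] at this
        exact (hl_Sd z this).symm
      · exact absurd (cM.closedBall_subset hz₀) hz₃
  have hbijH : BijOn H univ univ := by
    have key : BijOn H (A₀ ∪ (A₁ ∪ (A₂ ∪ A₃))) (A₀ ∪ (B₁ ∪ (B₂ ∪ B₃))) := by
      refine bijOn_piecewise (bijOn_id _) hbij₁₂₃ hagree₀ ?_
      rw [image_id]
      rintro y ⟨hy₀, hy | hy | hy⟩
      · have : y ∈ closure cT.Vu ∩ closedBall 0 1 := ⟨hy, hy₀⟩
        rw [cT.closure_Vu_inter_closedBall, ← cM.closure_Vu_inter_closedBall] at this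
        exact ⟨hy₀, Or.inl this.1⟩
      · have : y ∈ closure cT.Wl ∩ closedBall 0 1 := ⟨hy, hy₀⟩
        rw [cT.closure_Wl_inter_closedBall, ← cM.closure_Wl_inter_closedBall] at this
        exact ⟨hy₀, Or.inr (Or.inl this.1)⟩
      · exact absurd (cT.closedBall_subset hy₀) hy
    rwa [hcover, hcoverT] at key
  have hcontH : Continuous H := by
    rw [← continuousOn_univ, ← hcover]
    exact continuousOn_piecewise_of_isClosed isClosed_closedBall (hA₁c.union (hA₂c.union hA₃c))
      continuousOn_id hcont₁₂₃ hagree₀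
  -- `H = ho` outside `E`
  have hH_A₃ : ∀ z ∈ A₃, H z = ho z := by
    intro z hz
    have hz₀ : z ∉ A₀ := fun h => hz (cM.closedBall_subset h)
    rw [hH, piecewise_eq_of_notMem _ _ _ hz₀]
    by_cases hz₁ : z ∈ A₁
    · rw [hg₁₂₃_A₁ z hz₁]
      have : z ∈ A₁ ∩ A₃ := ⟨hz₁, hz⟩
      rw [hA₁, hA₃, cM.closure_Vu_inter_compl] at this
      exact (huo_Ku z this).1
    · rw [hg₁₂₃, piecewise_eq_of_notMem _ _ _ hz₁, hg₂₃_A₃ z hz]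
  -- properness
  have hbdd : IsBounded (A₀ ∪ (A₁ ∪ A₂)) :=
    isBounded_closedBall.union (cM.isBounded_Vu.closure.union (cM.isBounded_E.subset cM.Wl_subset_E).closure)
  have hprop : Tendsto H (cocompact ℂ) (cocompact ℂ) := by
    refine Filter.tendsto_cocompact_cocompact_of_norm fun ε => ?_
    have hK : IsCompact (ho ⁻¹' closedBall 0 ε) := ho.isCompact_preimage.2 (isCompact_closedBall 0 ε)
    obtain ⟨r₀, hr₀⟩ := hK.isBounded.subset_ball 0
    obtain ⟨r₁, hr₁⟩ := (hbdd.union cM.isBounded_E).subset_ball 0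
    refine ⟨max r₀ r₁, fun z hz => ?_⟩
    have hz₀ : z ∉ ball (0 : ℂ) r₀ := fun h => by
      have := mem_ball_zero_iff.1 h; linarith [le_max_left r₀ r₁]
    have hz₁ : z ∉ ball (0 : ℂ) r₁ := fun h => by
      have := mem_ball_zero_iff.1 h; linarith [le_max_right r₀ r₁]
    have hzA₃ : z ∈ A₃ := fun h => hz₁ (hr₁ (Or.inr h))
    rw [hH_A₃ z hzA₃]
    by_contra hle
    push Not at hle
    exact hz₀ (hr₀ (mem_closedBall_zero_iff.2 hle))
  have hHhomeo : IsHomeomorph H :=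
    isHomeomorph_iff_continuous_isClosedMap_bijective.2 ⟨hcontH,
      (isProperMap_iff_tendsto_cocompact.2 ⟨hcontH, hprop⟩).isClosedMap,
      bijOn_univ.1 hbijH⟩
  set Hh : ℂ ≃ₜ ℂ := hHhomeo.homeomorph H with hHh
  have hHh_apply : ∀ z, Hh z = H z := fun z => rfl
  refine ⟨Hh, fun z hz => ?_, ?_, ?_, ?_⟩
  · rw [hHh_apply, hH, piecewise_eq_of_mem _ _ _ (mem_closedBall_zero_iff.2 hz)]; rfl
  · -- `H '' E = (H '' Eᶜ)ᶜ = (Eᶜ)ᶜ`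
    have h1 : Hh '' cM.Eᶜ = cT.Eᶜ := by
      show Hh '' A₃ = B₃
      rw [← ho_A₃]
      exact image_congr fun z hz => hH_A₃ z hz
    have h2 : Hh '' cM.E = (Hh '' cM.Eᶜ)ᶜ := by
      rw [Hh.image_compl, compl_compl]
    rw [h2, h1, compl_compl]
  · rw [← hofr]
    exact image_congr fun z hz => hH_A₃ z (cM.not_mem_E_of_mem_frontier hz)
  · rw [← hoext]
    refine image_congr fun z hz => hH_A₃ z ?_
    exact fun h => hz (subset_closure h)

end CutData

end Literature.Topology.PlaneTopology

end

noncomputable section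

namespace Literature.Topology.PlaneTopology

open Set Metric Real Filter _root_.Topology Bornology
open Literature.Probability.RandomPlanarGeometry (JordanDomain)
open Literature.Probability.RandomPlanarGeometry.JordanDomain

/-! ### The annulus theorem -/

section Main

/-- Images of the standard round pieces under a norm-preserving bijection. [folklore] -/
theorem image_ball_sphere_of_norm_eq {Φ : ℂ ≃ₜ ℂ} (hn : ∀ z, ‖Φ z‖ = ‖z‖) (r : ℝ) :
    Φ '' ball 0 r = ball 0 r ∧ Φ '' sphere 0 r = sphere 0 r ∧ Φ '' closedBall 0 r = closedBall 0 r ∧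
      Φ '' (closedBall 0 r)ᶜ = (closedBall 0 r)ᶜ := by
  have h := fun (p : ℝ → Prop) => image_eq_of_norm_eq Φ.bijective hn (p := p)
  refine ⟨?_, ?_, ?_, ?_⟩
  · simpa [ball, dist_zero_right] using h (· < r)
  · simpa [sphere, dist_zero_right] using h (· = r)
  · simpa [closedBall, dist_zero_right] using h (· ≤ r)
  · have := h (fun x => ¬ x ≤ r)
    simpa [closedBall, dist_zero_right, compl_setOf] using this

/-- **Annulus theorem, normalised form.** If the closed unit disc lies in a Jordan domain `E`,
there is a homeomorphism of `ℂ`, equal to the identity on the closed unit disc, mapping the disc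
of radius `2` onto `E`, the circle of radius `2` onto `∂E` and the outside onto the outside — so
the closed region between the unit circle and `∂E` is a closed annulus. (From two cut data, of
the disc of radius `2` and of `E`, by `CutData.exists_homeomorph`; Moise 1977, Ch. 4.)
[folklore] -/
theorem exists_homeomorph_closedBall_fixed (E : JordanDomain) (hE : closedBall (0 : ℂ) 1 ⊆ E.carrier) :
    ∃ H : ℂ ≃ₜ ℂ, (∀ z, ‖z‖ ≤ 1 → H z = z) ∧ H '' ball 0 2 = E.carrier ∧
      H '' sphere 0 2 = frontier E.carrier ∧ H '' (closedBall 0 2)ᶜ = (closure E.carrier)ᶜ := by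
  obtain ⟨cM, hcM⟩ := exists_cutData (disc 2 two_pos)
    ((closedBall_subset_ball (by norm_num : (1 : ℝ) < 2)).trans (by simp))
  obtain ⟨cT, hcT⟩ := exists_cutData E hE
  obtain ⟨H, hid, hE', hfr, hext⟩ := CutData.exists_homeomorph cM cT
  rw [hcM, hcT, carrier_disc] at hE' hfr hext
  rw [frontier_ball _ two_ne_zero] at hfr
  rw [closure_ball _ two_ne_zero] at hext
  exact ⟨H, hid, hE', hfr, hext⟩

/-- **Annulus theorem, normalised form with prescribed outer boundary values.** With `E` as
above and a homeomorphism `g` of the circle of radius `2` onto `∂E`, the homeomorphism can be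
taken equal to `g` on that circle, at the price of being either the identity or complex
conjugation on the closed unit disc (correction by the circle-twist of
`exists_homeomorph_extend_circle`). [folklore] -/
theorem exists_homeomorph_closedBall_fixed_eqOn (E : JordanDomain) (hE : closedBall (0 : ℂ) 1 ⊆ E.carrier)
    {g : ℂ → ℂ} (hgc : ContinuousOn g (sphere 0 2)) (hg : BijOn g (sphere 0 2) (frontier E.carrier)) :
    ∃ H : ℂ ≃ₜ ℂ, EqOn H g (sphere 0 2) ∧
      ((∀ z, ‖z‖ ≤ 1 → H z = z) ∨ (∀ z, ‖z‖ ≤ 1 → H z = (starRingEnd ℂ) z)) ∧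
      H '' ball 0 2 = E.carrier ∧ H '' sphere 0 2 = frontier E.carrier ∧
      H '' (closedBall 0 2)ᶜ = (closure E.carrier)ᶜ := by
  obtain ⟨H₀, hid, hball, hsph, hext⟩ := exists_homeomorph_closedBall_fixed E hE
  -- the circle homeomorphism `k = H₀⁻¹ ∘ g`
  set k : ℂ → ℂ := fun z => H₀.symm (g z) with hk
  have hkc : ContinuousOn k (sphere 0 2) := H₀.symm.continuous.comp_continuousOn hgc
  have hH₀b : BijOn H₀ (sphere 0 2) (frontier E.carrier) := hsph ▸ H₀.injective.injOn.bijOn_image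
  have hH₀b' : BijOn H₀.symm (frontier E.carrier) (sphere 0 2) :=
    (H₀.toEquiv.bijOn_symm (s := sphere 0 2) (t := frontier E.carrier)).2 hH₀b
  have hkb : BijOn k (sphere 0 2) (sphere 0 2) := hH₀b'.comp hg
  obtain ⟨Φ, hΦk, hΦn, hΦin⟩ := exists_homeomorph_extend_circle hkc hkb
  obtain ⟨hΦball, hΦsph, -, hΦext⟩ := image_ball_sphere_of_norm_eq hΦn 2
  refine ⟨Φ.trans H₀, fun z hz => ?_, ?_, ?_, ?_, ?_⟩
  · show H₀ (Φ z) = g z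
    rw [hΦk hz, hk]; exact H₀.apply_symm_apply _
  · rcases hΦin with h | h
    · left; intro z hz
      show H₀ (Φ z) = z
      rw [h z hz, hid z hz]
    · right; intro z hz
      show H₀ (Φ z) = (starRingEnd ℂ) z
      rw [h z hz, hid _ (by rwa [Complex.norm_conj])]
  · show (H₀ ∘ Φ) '' ball 0 2 = E.carrier
    rw [image_comp, hΦball, hball]
  · show (H₀ ∘ Φ) '' sphere 0 2 = frontier E.carrier
    rw [image_comp, hΦsph, hsph]
  · show (H₀ ∘ Φ) '' (closedBall 0 2)ᶜ = (closure E.carrier)ᶜ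
    rw [image_comp, hΦext, hext]

/-- The image of the unit ball / circle under a map which is the identity or conjugation on the
closed unit disc. [folklore] -/
theorem image_ball_sphere_of_id_or_conj {H : ℂ → ℂ}
    (h : (∀ z, ‖z‖ ≤ 1 → H z = z) ∨ (∀ z, ‖z‖ ≤ 1 → H z = (starRingEnd ℂ) z)) :
    H '' ball 0 1 = ball 0 1 ∧ H '' sphere 0 1 = sphere 0 1 ∧ H '' closedBall 0 1 = closedBall 0 1 := by
  rcases h with h | h
  · refine ⟨?_, ?_, ?_⟩
    · exact (image_congr fun z hz => h z (mem_ball_zero_iff.1 hz).le).trans (image_id' _)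
    · exact (image_congr fun z hz => h z (mem_sphere_zero_iff_norm.1 hz).le).trans (image_id' _)
    · exact (image_congr fun z hz => h z (mem_closedBall_zero_iff.1 hz)).trans (image_id' _)
  · have key : ∀ {p : ℝ → Prop}, (∀ z ∈ {z : ℂ | p ‖z‖}, ‖z‖ ≤ 1) →
        H '' {z : ℂ | p ‖z‖} = {z : ℂ | p ‖z‖} := by
      intro p hp
      ext w; constructor
      · rintro ⟨z, hz, rfl⟩
        rw [h z (hp z hz)]; simpa using hz
      · intro hw
        refine ⟨(starRingEnd ℂ) w, by simpa using hw, ?_⟩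
        rw [h _ (by rw [Complex.norm_conj]; exact hp w hw), Complex.conj_conj]
    refine ⟨?_, ?_, ?_⟩
    · simpa [ball, dist_zero_right] using key (p := (· < 1)) (fun z hz => le_of_lt hz)
    · simpa [sphere, dist_zero_right] using key (p := (· = 1)) (fun z hz => le_of_eq hz)
    · simpa [closedBall, dist_zero_right] using key (p := (· ≤ 1)) (fun z hz => hz)

/-- **The two-dimensional annulus theorem, with boundary values** (Schoenflies 1906; e.g.
Moise, *Geometric topology in dimensions 2 and 3* (1977), Ch. 4; proved here from the Jordan
curve theorem, Newman's cross-cut theorem and the Schoenflies theorem of the tree). Let `D₁`,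
`D₂` be Jordan domains with `closure D₁ ⊆ D₂`, and let `g₁ : {‖z‖ = 1} → ∂D₁`,
`g₂ : {‖z‖ = 2} → ∂D₂` be homeomorphisms (continuous bijections). Then there is a homeomorphism
`H` of `ℂ` with `H = g₂` on the circle of radius `2` and `H = g₁` *or* `H = g₁ ∘ conj` on the
unit circle, mapping the unit disc onto `D₁`, the disc of radius `2` onto `D₂` and the outside of
the latter onto the outside of `D₂`; in particular the closed round annulus `1 ≤ ‖z‖ ≤ 2` is
mapped homeomorphically onto `closure D₂ ∖ D₁`. (The alternative `g₁ ∘ conj` is forced when the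
two prescribed boundary maps have opposite orientations.) [folklore] -/
theorem annulus_theorem {D₁ D₂ : JordanDomain} (h : closure D₁.carrier ⊆ D₂.carrier)
    {g₁ g₂ : ℂ → ℂ} (hg₁c : ContinuousOn g₁ (sphere 0 1)) (hg₁ : BijOn g₁ (sphere 0 1) (frontier D₁.carrier))
    (hg₂c : ContinuousOn g₂ (sphere 0 2)) (hg₂ : BijOn g₂ (sphere 0 2) (frontier D₂.carrier)) :
    ∃ H : ℂ ≃ₜ ℂ, EqOn H g₂ (sphere 0 2) ∧
      (EqOn H g₁ (sphere 0 1) ∨ EqOn H (g₁ ∘ starRingEnd ℂ) (sphere 0 1)) ∧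
      H '' ball 0 1 = D₁.carrier ∧ H '' sphere 0 1 = frontier D₁.carrier ∧
      H '' ball 0 2 = D₂.carrier ∧ H '' sphere 0 2 = frontier D₂.carrier ∧
      H '' (closedBall 0 2)ᶜ = (closure D₂.carrier)ᶜ := by
  -- Schoenflies: straighten the inner curve to the unit circle with the prescribed `g₁`
  have hfr₁ : frontier unitDisc.carrier = sphere (0 : ℂ) 1 := by
    rw [carrier_unitDisc, frontier_ball _ one_ne_zero]
  obtain ⟨S, hSg, hSball, hSsph, hSext⟩ :=
    unitDisc.exists_homeomorph_eqOn_frontier D₁ (φ := g₁) (hfr₁ ▸ hg₁c) (hfr₁ ▸ hg₁)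
  rw [hfr₁] at hSg hSsph
  rw [carrier_unitDisc] at hSball hSext
  rw [closure_ball _ one_ne_zero] at hSext
  have hSclosed : S '' closedBall 0 1 = closure D₁.carrier := by
    rw [← ball_union_sphere, image_union, hSball, hSsph, closure_eq_self_union_frontier]
  -- the pulled-back outer domain
  set E : JordanDomain := D₂.imageHomeomorph S.symm with hE
  have hEc : E.carrier = S.symm '' D₂.carrier := rfl
  have hEfr : frontier E.carrier = S.symm '' frontier D₂.carrier := frontier_imageHomeomorph_carrier D₂ S.symm
  have hEcl : closure E.carrier = S.symm '' closure D₂.carrier := closure_imageHomeomorph_carrier D₂ S.symm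
  have hE1 : closedBall (0 : ℂ) 1 ⊆ E.carrier := by
    intro z hz
    rw [hEc]
    refine ⟨S z, h ?_, S.symm_apply_apply z⟩
    rw [← hSclosed]; exact mem_image_of_mem S hz
  -- the pulled-back outer boundary values
  set g : ℂ → ℂ := fun z => S.symm (g₂ z) with hg
  have hgc : ContinuousOn g (sphere 0 2) := S.symm.continuous.comp_continuousOn hg₂c
  have hgb : BijOn g (sphere 0 2) (frontier E.carrier) := by
    rw [hEfr]
    exact (S.symm.injective.injOn.bijOn_image).comp hg₂
  obtain ⟨H', hH'g, hH'in, hH'ball, hH'sph, hH'ext⟩ := exists_homeomorph_closedBall_fixed_eqOn E hE1 hgc hgb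
  have hSS : ∀ s : Set ℂ, S '' (S.symm '' s) = s := fun s => by
    rw [image_image]; simp
  obtain ⟨hb1, hs1, -⟩ := image_ball_sphere_of_id_or_conj hH'in
  refine ⟨H'.trans S, fun z hz => ?_, ?_, ?_, ?_, ?_, ?_, ?_⟩
  · show S (H' z) = g₂ z
    rw [hH'g hz, hg]; exact S.apply_symm_apply _
  · rcases hH'in with h' | h'
    · left; intro z hz
      show S (H' z) = g₁ z
      rw [h' z (mem_sphere_zero_iff_norm.1 hz).le, hSg hz]
    · right; intro z hz
      show S (H' z) = g₁ ((starRingEnd ℂ) z)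
      rw [h' z (mem_sphere_zero_iff_norm.1 hz).le, hSg (by simpa using hz)]
  · show (S ∘ H') '' ball 0 1 = D₁.carrier
    rw [image_comp, hb1, hSball]
  · show (S ∘ H') '' sphere 0 1 = frontier D₁.carrier
    rw [image_comp, hs1, hSsph]
  · show (S ∘ H') '' ball 0 2 = D₂.carrier
    rw [image_comp, hH'ball, hEc, hSS]
  · show (S ∘ H') '' sphere 0 2 = frontier D₂.carrier
    rw [image_comp, hH'sph, hEfr, hSS]
  · show (S ∘ H') '' (closedBall 0 2)ᶜ = (closure D₂.carrier)ᶜ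
    rw [image_comp, hH'ext, hEcl, ← image_compl_eq S.symm.bijective, hSS]

/-- **The annulus theorem, set form**: the closed region between two nested Jordan curves is
homeomorphic to the closed round annulus `1 ≤ ‖z‖ ≤ 2`, by the restriction of a homeomorphism
of the plane mapping the inner domain onto the unit disc. [folklore] -/
theorem exists_homeomorph_image_annulus {D₁ D₂ : JordanDomain} (h : closure D₁.carrier ⊆ D₂.carrier) :
    ∃ H : ℂ ≃ₜ ℂ, H '' ball 0 1 = D₁.carrier ∧ H '' ball 0 2 = D₂.carrier ∧
      H '' {z | 1 ≤ ‖z‖ ∧ ‖z‖ ≤ 2} = closure D₂.carrier \ D₁.carrier := by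
  obtain ⟨e₁⟩ := D₁.frontier_homeomorphic_addCircle
  obtain ⟨e₂⟩ := D₂.frontier_homeomorphic_addCircle
  -- boundary parametrisations from Schoenflies homeomorphisms of the round circle
  obtain ⟨T₁, hT₁sph, -⟩ := exists_homeomorph_image_sphere_eq ⟨e₁⟩
  obtain ⟨T₂, hT₂sph, -⟩ := exists_homeomorph_image_sphere_eq ⟨e₂⟩
  -- `g₁ = T₁` on the unit circle, `g₂ = T₂ ∘ (z ↦ z/2)` on the circle of radius 2
  have hg₁ : BijOn T₁ (sphere 0 1) (frontier D₁.carrier) := hT₁sph ▸ T₁.injective.injOn.bijOn_image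
  set g₂ : ℂ → ℂ := fun z => T₂ (z / 2) with hg₂
  have hhalf : (fun z : ℂ => z / 2) '' sphere 0 2 = sphere 0 1 := by
    ext w; simp only [mem_image, mem_sphere_zero_iff_norm]
    constructor
    · rintro ⟨z, hz, rfl⟩; rw [norm_div, hz]; norm_num
    · intro hw; exact ⟨2 * w, by rw [norm_mul, hw]; norm_num, by ring⟩
  have hg₂b : BijOn g₂ (sphere 0 2) (frontier D₂.carrier) := by
    rw [← hT₂sph, ← hhalf, ← image_comp]
    refine InjOn.bijOn_image ?_
    have hinj : Function.Injective fun z : ℂ => z / 2 := fun a b hab => by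
      have : a / 2 = b / 2 := hab
      linear_combination 2 * this
    exact (T₂.injective.comp hinj).injOn
  have hg₂c : ContinuousOn g₂ (sphere 0 2) := (T₂.continuous.comp (continuous_id.div_const _)).continuousOn
  obtain ⟨H, -, -, hb1, hs1, hb2, hs2, -⟩ :=
    annulus_theorem h T₁.continuous.continuousOn hg₁ hg₂c hg₂b
  refine ⟨H, hb1, hb2, ?_⟩
  have hset : {z : ℂ | 1 ≤ ‖z‖ ∧ ‖z‖ ≤ 2} = closedBall 0 2 \ ball 0 1 := by
    ext z
    simp only [mem_setOf_eq, Set.mem_sdiff, mem_closedBall_zero_iff, mem_ball_zero_iff, not_lt, and_comm]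
  have hcb2 : H '' closedBall 0 2 = closure D₂.carrier := by
    rw [← ball_union_sphere, image_union, hb2, hs2, closure_eq_self_union_frontier]
  rw [hset, image_sdiff H.injective, hcb2, hb1]

/-- **Extending a homeomorphism of the closed unit disc onto a closed Jordan disc, with compact
support** (the `0`-handle form of the annulus theorem). Let `D` be a Jordan domain with
`closure D ⊆ {‖z‖ < 2}` and `G` a homeomorphism of the closed unit disc onto `closure D` mapping
the open disc into `D` and the unit circle into `∂D`. Then `G` or `G ∘ conj` extends to a
homeomorphism of `ℂ` which is the identity on `{‖z‖ ≥ 2}`. [folklore] -/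
theorem exists_homeomorph_extend_closedBall (D : JordanDomain) (hD : closure D.carrier ⊆ ball 0 2)
    {G : ℂ → ℂ} (hGc : ContinuousOn G (closedBall 0 1)) (hG : BijOn G (closedBall 0 1) (closure D.carrier))
    (hGb : MapsTo G (ball 0 1) D.carrier) (hGs : MapsTo G (sphere 0 1) (frontier D.carrier)) :
    ∃ H : ℂ ≃ₜ ℂ, (∀ z, 2 ≤ ‖z‖ → H z = z) ∧
      (EqOn H G (closedBall 0 1) ∨ EqOn H (G ∘ starRingEnd ℂ) (closedBall 0 1)) ∧
      H '' closedBall 0 1 = closure D.carrier ∧ H '' ball 0 1 = D.carrier := by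
  classical
  -- `G` restricted to the unit circle is a homeomorphism onto `∂D`
  have hnot : ∀ p ∈ frontier D.carrier, p ∉ D.carrier := fun p hp h =>
    (Set.disjoint_left.1 (Set.disjoint_iff_inter_eq_empty.2 D.isOpen.inter_frontier_eq) h) hp
  have hGsph : BijOn G (sphere 0 1) (frontier D.carrier) := by
    refine ⟨hGs, hG.injOn.mono sphere_subset_closedBall, fun p hp => ?_⟩
    obtain ⟨z, hz, rfl⟩ := hG.surjOn (frontier_subset_closure hp)
    have : z ∉ ball (0 : ℂ) 1 := fun h => hnot _ hp (hGb h)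
    refine ⟨z, ?_, rfl⟩
    have hz1 : ‖z‖ ≤ 1 := mem_closedBall_zero_iff.1 hz
    have hz1' : ¬ ‖z‖ < 1 := fun h => this (mem_ball_zero_iff.2 h)
    exact mem_sphere_zero_iff_norm.2 (le_antisymm hz1 (not_lt.1 hz1'))
  -- the annulus theorem with outer map the identity
  have hD2 : closure D.carrier ⊆ (disc 2 two_pos).carrier := by simpa using hD
  have hid : BijOn (fun z : ℂ => z) (sphere 0 2) (frontier (disc 2 two_pos).carrier) := by
    rw [frontier_disc_carrier]; exact bijOn_id _
  obtain ⟨H₃, hH₃id, hH₃G, hb1, hs1, hb2, hs2, hext⟩ :=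
    annulus_theorem hD2 (hGc.mono sphere_subset_closedBall) hGsph continuousOn_id hid
  simp only [carrier_disc] at hb2 hs2 hext
  rw [frontier_ball _ two_ne_zero] at hs2
  rw [closure_ball _ two_ne_zero] at hext
  -- the inner map `G' = G` or `G ∘ conj`
  obtain ⟨G', hG'c, hG'b, hG'eq, hG'alt⟩ : ∃ G' : ℂ → ℂ, ContinuousOn G' (closedBall 0 1) ∧
      BijOn G' (closedBall 0 1) (closure D.carrier) ∧ EqOn H₃ G' (sphere 0 1) ∧
      (G' = G ∨ G' = G ∘ starRingEnd ℂ) := by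
    rcases hH₃G with h | h
    · exact ⟨G, hGc, hG, h, Or.inl rfl⟩
    · refine ⟨G ∘ starRingEnd ℂ, ?_, ?_, h, Or.inr rfl⟩
      · refine hGc.comp Complex.continuous_conj.continuousOn fun z hz => ?_
        simpa using hz
      · refine hG.comp ⟨fun z hz => by simpa using hz, (starRingEnd ℂ).injective.injOn, fun z hz => ?_⟩
        exact ⟨(starRingEnd ℂ) z, by simpa using hz, Complex.conj_conj z⟩
  -- the three pieces
  set X₁ : Set ℂ := closedBall 0 1 with hX₁
  set X₂ : Set ℂ := {z | 1 ≤ ‖z‖ ∧ ‖z‖ ≤ 2} with hX₂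
  set X₃ : Set ℂ := {z | 2 ≤ ‖z‖} with hX₃
  have hX₂c : IsClosed X₂ := by
    have : X₂ = {z : ℂ | 1 ≤ ‖z‖} ∩ closedBall 0 2 := by
      ext z; simp [hX₂]
    rw [this]
    exact (isClosed_le continuous_const continuous_norm).inter isClosed_closedBall
  have hX₃c : IsClosed X₃ := isClosed_le continuous_const continuous_norm
  have hX₂eq : X₂ = closedBall 0 2 \ ball 0 1 := by
    ext z; simp [hX₂, and_comm]
  have hH₃cb : H₃ '' closedBall 0 2 = closedBall 0 2 := by
    rw [← ball_union_sphere, image_union, hb2, hs2]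
  have hH₃X₂ : H₃ '' X₂ = closedBall 0 2 \ D.carrier := by
    rw [hX₂eq, image_sdiff H₃.injective, hH₃cb, hb1]
  have hX₂₃ : X₂ ∩ X₃ = sphere 0 2 := by
    ext z; simp only [hX₂, hX₃, mem_inter_iff, mem_setOf_eq, mem_sphere_zero_iff_norm]
    constructor
    · rintro ⟨⟨-, h2⟩, h3⟩; exact le_antisymm h2 h3
    · intro h; rw [h]; norm_num
  have hX₁₂ : X₁ ∩ (X₂ ∪ X₃) = sphere 0 1 := by
    ext z; simp only [hX₁, hX₂, hX₃, mem_inter_iff, mem_union, mem_setOf_eq, mem_closedBall_zero_iff,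
      mem_sphere_zero_iff_norm]
    constructor
    · rintro ⟨h1, ⟨h2, -⟩ | h3⟩
      · exact le_antisymm h1 h2
      · linarith
    · intro h; rw [h]; norm_num
  have hcover : X₁ ∪ (X₂ ∪ X₃) = univ := by
    refine eq_univ_of_forall fun z => ?_
    simp only [hX₁, hX₂, hX₃, mem_union, mem_closedBall_zero_iff, mem_setOf_eq]
    rcases le_or_gt ‖z‖ 1 with h | h
    · exact Or.inl h
    · rcases le_or_gt ‖z‖ 2 with h' | h'
      · exact Or.inr (Or.inl ⟨h.le, h'⟩)
      · exact Or.inr (Or.inr h'.le)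
  -- step a: paste `H₃` on the annulus with the identity outside
  set F₁ : ℂ → ℂ := X₂.piecewise H₃ id with hF₁
  have hagree₂₃ : EqOn H₃ id (X₂ ∩ X₃) := by rw [hX₂₃]; exact hH₃id
  have hbijX₂ : BijOn H₃ X₂ (closedBall 0 2 \ D.carrier) := hH₃X₂ ▸ H₃.injective.injOn.bijOn_image
  have hbij₂₃ : BijOn F₁ (X₂ ∪ X₃) ((closedBall 0 2 \ D.carrier) ∪ X₃) := by
    rw [hF₁]
    refine bijOn_piecewise hbijX₂ (bijOn_id _) hagree₂₃ ?_
    rw [hX₂₃, hs2]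
    rintro y ⟨⟨hy2, -⟩, hy3⟩
    exact mem_sphere_zero_iff_norm.2 (le_antisymm (mem_closedBall_zero_iff.1 hy2) hy3)
  have hcont₂₃ : ContinuousOn F₁ (X₂ ∪ X₃) := by
    rw [hF₁]
    exact continuousOn_piecewise_of_isClosed hX₂c hX₃c H₃.continuous.continuousOn continuousOn_id hagree₂₃
  -- step b: paste `G'` on the closed unit disc
  set F : ℂ → ℂ := X₁.piecewise G' F₁ with hF
  have hagree₁ : EqOn G' F₁ (X₁ ∩ (X₂ ∪ X₃)) := by
    rw [hX₁₂]
    intro z hz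
    have hz₂ : z ∈ X₂ := ⟨(mem_sphere_zero_iff_norm.1 hz).ge, by rw [mem_sphere_zero_iff_norm.1 hz]; norm_num⟩
    rw [hF₁, piecewise_eq_of_mem _ _ _ hz₂]
    exact (hG'eq hz).symm
  have hcoverT : closure D.carrier ∪ ((closedBall 0 2 \ D.carrier) ∪ X₃) = univ := by
    refine eq_univ_of_forall fun z => ?_
    by_cases hz : z ∈ D.carrier
    · exact Or.inl (subset_closure hz)
    · rcases le_or_gt ‖z‖ 2 with h | h
      · exact Or.inr (Or.inl ⟨mem_closedBall_zero_iff.2 h, hz⟩)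
      · exact Or.inr (Or.inr h.le)
  have hbijF : BijOn F univ univ := by
    have key : BijOn F (X₁ ∪ (X₂ ∪ X₃)) (closure D.carrier ∪ ((closedBall 0 2 \ D.carrier) ∪ X₃)) := by
      rw [hF]
      refine bijOn_piecewise hG'b hbij₂₃ hagree₁ ?_
      rw [hX₁₂]
      rintro y ⟨hy₁, hy | hy⟩
      · -- `y ∈ closure D ∖ D = ∂D = G' '' sphere`
        have hyfr : y ∈ frontier D.carrier := by
          rw [frontier_eq_closure_inter_closure, D.isOpen.isClosed_compl.closure_eq]; exact ⟨hy₁, hy.2⟩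
        have hG'sph : SurjOn G' (sphere 0 1) (frontier D.carrier) := by
          rcases hG'alt with rfl | rfl
          · exact hGsph.surjOn
          · intro p hp
            obtain ⟨z, hz, rfl⟩ := hGsph.surjOn hp
            exact ⟨(starRingEnd ℂ) z, by simpa using hz, by simp⟩
        obtain ⟨z, hz, rfl⟩ := hG'sph hyfr
        exact ⟨z, hz, rfl⟩
      · exfalso
        have h2 : ‖y‖ < 2 := mem_ball_zero_iff.1 (hD hy₁)
        exact absurd hy (not_le.2 h2)
    rwa [hcover, hcoverT] at key
  have hcontF : Continuous F := by
    rw [← continuousOn_univ, ← hcover, hF]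
    exact continuousOn_piecewise_of_isClosed isClosed_closedBall (hX₂c.union hX₃c) hG'c hcont₂₃ hagree₁
  -- `F = id` on `X₃`
  have hF_X₃ : ∀ z ∈ X₃, F z = z := by
    intro z hz
    have hz2 : 2 ≤ ‖z‖ := hz
    have hz₁ : z ∉ X₁ := fun h => by
      have := mem_closedBall_zero_iff.1 h; linarith
    rw [hF, piecewise_eq_of_notMem _ _ _ hz₁, hF₁]
    by_cases hz₂ : z ∈ X₂
    · rw [piecewise_eq_of_mem _ _ _ hz₂]; exact hagree₂₃ ⟨hz₂, hz⟩
    · rw [piecewise_eq_of_notMem _ _ _ hz₂]; rfl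
  have hprop : Tendsto F (cocompact ℂ) (cocompact ℂ) := by
    refine Filter.tendsto_cocompact_cocompact_of_norm fun ε => ⟨max ε 2, fun z hz => ?_⟩
    rw [hF_X₃ z (show 2 ≤ ‖z‖ by linarith [le_max_right ε 2])]
    linarith [le_max_left ε 2]
  have hFhomeo : IsHomeomorph F :=
    isHomeomorph_iff_continuous_isClosedMap_bijective.2 ⟨hcontF,
      (isProperMap_iff_tendsto_cocompact.2 ⟨hcontF, hprop⟩).isClosedMap, bijOn_univ.1 hbijF⟩
  have hFX₁ : EqOn F G' (closedBall 0 1) := fun z hz => piecewise_eq_of_mem _ _ _ hz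
  refine ⟨hFhomeo.homeomorph F, fun z hz => hF_X₃ z hz, ?_, ?_, ?_⟩
  · rcases hG'alt with rfl | rfl
    · exact Or.inl hFX₁
    · exact Or.inr hFX₁
  · show F '' closedBall 0 1 = closure D.carrier
    rw [image_congr hFX₁]; exact hG'b.image_eq
  · show F '' ball 0 1 = D.carrier
    rw [image_congr (hFX₁.mono ball_subset_closedBall)]
    -- `G'` maps the open disc onto `D`: it maps the closed disc onto `closure D`, the circle
    -- onto `∂D`, injectively
    have hG'ball : MapsTo G' (ball 0 1) D.carrier := by
      rcases hG'alt with rfl | rfl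
      · exact hGb
      · exact fun z hz => hGb (by simpa using hz)
    refine Subset.antisymm (mapsTo_iff_image_subset.1 hG'ball) fun p hp => ?_
    obtain ⟨z, hz, rfl⟩ := hG'b.surjOn (subset_closure hp)
    refine ⟨z, ?_, rfl⟩
    by_contra hzb
    have hzs : z ∈ sphere (0 : ℂ) 1 := by
      have h1 := mem_closedBall_zero_iff.1 hz
      have h2 : ¬ ‖z‖ < 1 := fun h' => hzb (mem_ball_zero_iff.2 h')
      exact mem_sphere_zero_iff_norm.2 (le_antisymm h1 (not_lt.1 h2))
    have : G' z ∈ frontier D.carrier := by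
      rw [← hG'eq hzs, ← hs1]; exact mem_image_of_mem _ hzs
    exact hnot _ this hp

end Main

end Literature.Topology.PlaneTopology

end
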